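import Mathlib
import Literature.Probability.LatticeModels.GKSInequalities
import Literature.LinearAlgebra.Matrix.InverseMMatrixProofs
import Summits.CriticalPhenomena.Ising3DConformalLimit.Theses.PrecisionLaplacian
import HarnessLib

/-!
# Crux `PrecisionLaplacian.InverseMFerromagnet` (stmt-CriticalPhenomena-4798), line `Sketch` —
# stub `stub_im_of_imDeg3` (C5, degree reduction by the contraction limit)

THEOREM-ONLY file (no definitions).  IM (the off-diagonal entries of the inverse of the spin
second-moment matrix `Σ_pq = ⟨σ_pσ_q⟩` of a zero-field pair ferromagnet are `≤ 0`) for all systems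
of maximal degree `≤ 3` implies IM for all systems.

Proof (contraction limit).  Sites `Fin n`, bonds `Fin m`.  If `m ≤ 1` every degree is `≤ 1`.  If
`m = k + 2`, blow every site `p` up into copies `(p, j)`, `j : Fin m`: the bond `i = {a, b}`
becomes `{(a, i), (b, i)}` (same coupling), and the copies of `p` are tied into the cycle
`(p, j) — (p, j + 1)` with coupling `L ≥ 0`.  Every copy lies in at most one original and two cycle
bonds, so (after relabelling sites and bonds by `Fin _`, under which `gksExpect`, degrees and
inverse entries are invariant) the hypothesis applies to the blow-up `G_L`; its second-moment
matrix is entrywise `≥ 0` (GKS I) and positive definite, hence inverse-M, and so is its principal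
submatrix `M_L` on the heads `(p, 0)` (DMS 2014, Lemma 2.32 = `principalSubmatrix_closure_holds`):
`(M_L⁻¹)_xy ≤ 0`.  Multiplying numerator and denominator of `gksExpect` by `e^{−L·#cycle bonds}`,
the weights of `G_L` converge as `L → ∞` to the original weights on fibre-constant configurations
and to `0` elsewhere, so `M_L → Σ` entrywise; `Σ` is positive definite, inversion is continuous
there, and `(Σ⁻¹)_xy = lim (M_L⁻¹)_xy ≤ 0`.  The positive-definiteness lemma is adapted (any
`Fintype` of sites) from `Theorems/PrecisionLaplacianInverseMFerromagnetEntryNonposOfPcov.lean`.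
-/

namespace Summit.CriticalPhenomena.Ising3DConformalLimit.Cruxes.InverseMFerromagnet.PartialCovarianceLadder

open Literature.Probability.LatticeModels Finset Matrix Filter Topology
open Literature.LinearAlgebra.Matrix (IsInverseMMatrix principalSubmatrix_closure_holds)
open Summit.CriticalPhenomena.Ising3DConformalLimit.Theses.PrecisionLaplacian (InverseMFerromagnet)
open scoped symmDiff

/-! ## The second-moment matrix on any finite site set: positive definite, entries `≥ 0` -/

-- adapted from Theorems/PrecisionLaplacianInverseMFerromagnetEntryNonposOfPcov.lean (`schur_posDef`)
/-- **The second-moment matrix `(⟨σ_pσ_q⟩)` is positive definite** on any finite site set (no sign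
hypothesis): `vᵀGv = ⟨(∑ v_pσ_p)²⟩ > 0` for `v ≠ 0`, testing on `σ_p = sign v_p`. [folklore] -/
theorem c5_posDef {V ι : Type*} [Fintype V] [DecidableEq V] (s : Finset ι) (K : ι → ℝ)
    (C : ι → Finset V) :
    (Matrix.of fun p q : V => gksExpect s K C (fun ω => spinAt p ω * spinAt q ω)).PosDef := by
  have hsum : ∀ g : V → SpinConfig V → ℝ,
      gksExpect s K C (fun ω => ∑ a, g a ω) = ∑ a, gksExpect s K C (g a) := by
    intro g
    unfold gksExpect gksSum
    rw [← Finset.sum_div]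
    simp_rw [Finset.sum_mul]
    rw [Finset.sum_comm]
  have hmul : ∀ (c : ℝ) (f : SpinConfig V → ℝ),
      gksExpect s K C (fun ω => c * f ω) = c * gksExpect s K C f := by
    intro c f
    unfold gksExpect gksSum
    simp_rw [mul_assoc]
    rw [← Finset.mul_sum, mul_div_assoc]
  -- the quadratic form is the second moment of `∑ v_p σ_p`
  have hquad : ∀ v : V → ℝ, dotProduct v ((Matrix.of fun p q : V =>
      gksExpect s K C (fun ω => spinAt p ω * spinAt q ω)).mulVec v) =
        gksExpect s K C (fun ω => (∑ p, v p * spinAt p ω) ^ 2) := by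
    intro v
    have hsq : (fun ω : SpinConfig V => (∑ p, v p * spinAt p ω) ^ 2)
        = fun ω => ∑ p, ∑ q, (v p * v q) * (spinAt p ω * spinAt q ω) := by
      funext ω
      rw [sq, Finset.sum_mul_sum]
      exact Finset.sum_congr rfl fun p _ => Finset.sum_congr rfl fun q _ => by ring
    rw [hsq, hsum]
    simp only [dotProduct, Matrix.mulVec, Matrix.of_apply]
    refine Finset.sum_congr rfl fun p _ => ?_
    rw [hsum, Finset.mul_sum]
    refine Finset.sum_congr rfl fun q _ => ?_
    rw [hmul]
    ring
  rw [Matrix.posDef_iff_dotProduct_mulVec]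
  refine ⟨?_, fun v hv => ?_⟩
  · refine Matrix.IsHermitian.ext fun p q => ?_
    simp only [Matrix.of_apply, star_trivial]
    exact congrArg _ (funext fun ω => mul_comm _ _)
  · simp only [star_trivial]
    rw [hquad]
    let ω₀ : SpinConfig V := fun p => if 0 ≤ v p then 1 else -1
    have hterm : ∀ p, v p * spinAt p ω₀ = |v p| := by
      intro p
      by_cases hp : 0 ≤ v p
      · simp [ω₀, spinAt, hp, abs_of_nonneg hp]
      · simp [ω₀, spinAt, hp, abs_of_neg (lt_of_not_ge hp)]
    obtain ⟨p, hp⟩ : ∃ p, v p ≠ 0 := not_forall.1 fun hall => hv (funext hall)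
    have hpos : 0 < ∑ q, |v q| :=
      Finset.sum_pos' (fun q _ => abs_nonneg _) ⟨p, Finset.mem_univ _, abs_pos.mpr hp⟩
    refine div_pos (Finset.sum_pos' (fun ω _ => mul_nonneg (sq_nonneg _) (gksWeight_pos s K C ω).le)
      ⟨ω₀, Finset.mem_univ _, mul_pos ?_ (gksWeight_pos s K C ω₀)⟩) (gksSum_one_pos s K C)
    simp_rw [hterm]
    positivity

/-- GKS I for the entries `⟨σ_pσ_q⟩ = ⟨σ_{{p} ∆ {q}}⟩ ≥ 0` of the second-moment matrix. [folklore] -/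
theorem c5_corr_nonneg {V ι : Type*} [Fintype V] [DecidableEq V] [Fintype ι] (K : ι → ℝ)
    (C : ι → Finset V) (hK : ∀ i, 0 ≤ K i) (p q : V) :
    0 ≤ gksExpect Finset.univ K C (fun ω => spinAt p ω * spinAt q ω) := by
  have h : (fun ω : SpinConfig V => spinAt p ω * spinAt q ω) = spinProduct (({p} : Finset V) ∆ {q}) :=
    funext fun ω => by rw [← spinProduct_mul_eq_spinProduct_symmDiff]; simp [spinProduct]
  exact h ▸ gksExpect_spinProduct_nonneg _ _ _ (fun i _ => hK i) _

/-! ## Relabelling sites and bonds; the hypothesis on arbitrary finite index types -/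

/-- `gksExpect` is invariant under a simultaneous relabelling of the sites (`eV`) and of the bonds
(`eι`). [folklore] -/
theorem c5_gksExpect_relabel {V V' ι ι' : Type*} [Fintype V] [DecidableEq V] [Fintype V']
    [DecidableEq V'] [Fintype ι] [Fintype ι'] (eV : V ≃ V') (eι : ι ≃ ι') (K : ι → ℝ)
    (C : ι → Finset V) (F : SpinConfig V → ℝ) :
    gksExpect Finset.univ (fun j => K (eι.symm j)) (fun j => (C (eι.symm j)).map eV.toEmbedding)
        (fun ω' => F (fun p => ω' (eV p))) = gksExpect Finset.univ K C F := by
  have hw : ∀ ω' : SpinConfig V',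
      gksWeight Finset.univ (fun j => K (eι.symm j)) (fun j => (C (eι.symm j)).map eV.toEmbedding) ω'
        = gksWeight Finset.univ K C (fun p => ω' (eV p)) := by
    intro ω'
    unfold gksWeight gksHamiltonian
    refine congrArg _ (Fintype.sum_equiv eι.symm _ _ fun j => ?_)
    rw [spinProduct, Finset.prod_map]
    rfl
  have hs : ∀ G : SpinConfig V → ℝ,
      gksSum Finset.univ (fun j => K (eι.symm j)) (fun j => (C (eι.symm j)).map eV.toEmbedding)
          (fun ω' => G (fun p => ω' (eV p))) = gksSum Finset.univ K C G := by
    intro G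
    simp only [gksSum, hw]
    exact Fintype.sum_equiv (eV.arrowCongr (Equiv.refl ℤˣ)).symm _ _ fun ω' => rfl
  unfold gksExpect
  rw [hs F, hs (fun _ => 1)]

/-- The degree-`≤ 3` hypothesis, stated for sites `Fin n` and bonds `Fin m`, transfers to arbitrary
finite index types (relabel by `Fintype.equivFin`; `(Σ.submatrix e e)⁻¹ = Σ⁻¹.submatrix e e`).
[folklore] -/
theorem c5_reindex
    (H : ∀ (n m : ℕ) (K : Fin m → ℝ) (C : Fin m → Finset (Fin n)), (∀ i, 0 ≤ K i) →
      (∀ i, (C i).card = 2) → (∀ p : Fin n, (Finset.univ.filter (fun i => p ∈ C i)).card ≤ 3) →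
      ∀ x y : Fin n, x ≠ y →
        (Matrix.of fun p q : Fin n =>
          gksExpect Finset.univ K C (fun ω => spinAt p ω * spinAt q ω))⁻¹ x y ≤ 0)
    {V ι : Type*} [Fintype V] [DecidableEq V] [Fintype ι] (K : ι → ℝ) (C : ι → Finset V)
    (hK : ∀ i, 0 ≤ K i) (hC : ∀ i, (C i).card = 2)
    (hdeg : ∀ p : V, (Finset.univ.filter (fun i => p ∈ C i)).card ≤ 3) (x y : V) (hxy : x ≠ y) :
    (Matrix.of fun p q : V =>
      gksExpect Finset.univ K C (fun ω => spinAt p ω * spinAt q ω))⁻¹ x y ≤ 0 := by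
  classical
  set eV : V ≃ Fin (Fintype.card V) := Fintype.equivFin V
  set eι : ι ≃ Fin (Fintype.card ι) := Fintype.equivFin ι
  have hmat : (Matrix.of fun p' q' : Fin (Fintype.card V) =>
        gksExpect Finset.univ (fun j => K (eι.symm j)) (fun j => (C (eι.symm j)).map eV.toEmbedding)
          (fun ω => spinAt p' ω * spinAt q' ω))
      = (Matrix.of fun p q : V =>
          gksExpect Finset.univ K C (fun ω => spinAt p ω * spinAt q ω)).submatrix eV.symm eV.symm := by
    ext p' q'
    simp only [Matrix.submatrix_apply, Matrix.of_apply]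
    rw [← c5_gksExpect_relabel eV eι K C]
    congr 1
    funext ω
    simp [spinAt]
  have hdeg' : ∀ p' : Fin (Fintype.card V),
      (Finset.univ.filter (fun j => p' ∈ (C (eι.symm j)).map eV.toEmbedding)).card ≤ 3 := by
    intro p'
    rw [Finset.card_equiv eι.symm (t := Finset.univ.filter (fun i => eV.symm p' ∈ C i))
      (fun j => by simp [Finset.mem_map_equiv])]
    exact hdeg _
  have h := H (Fintype.card V) (Fintype.card ι) (fun j => K (eι.symm j))
    (fun j => (C (eι.symm j)).map eV.toEmbedding) (fun j => hK _)
    (fun j => by rw [Finset.card_map]; exact hC _) hdeg' (eV x) (eV y) (eV.injective.ne hxy)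
  rw [hmat, Matrix.inv_submatrix_equiv] at h
  simpa [Matrix.submatrix_apply] using h

/-! ## The contraction limit `L → ∞` for a system with extra bonds of coupling `L` -/

/-- **Contraction limit, unnormalised.** For couplings `K` on bonds `C'` plus extra bonds `E`, all
of coupling `L`: `e^{−L·#E} · Z⟨G⟩_L → ∑_{ω : every extra bond satisfied} G(ω) e^{∑ K_i ω_{C'_i}}`
as `L → ∞` (each extra bond contributes a factor `e^{L(ω_{E_e} − 1)} ∈ {1, e^{−2L}}`). [folklore] -/
theorem c5_tendsto_gksSum {W ι κ : Type*} [Fintype W] [DecidableEq W] [Fintype ι] [Fintype κ]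
    (K : ι → ℝ) (C' : ι → Finset W) (E : κ → Finset W) (P : SpinConfig W → Prop)
    [DecidablePred P] (hP : ∀ ω, P ω ↔ ∀ e, spinProduct (E e) ω = 1) (G : SpinConfig W → ℝ) :
    Tendsto (fun L : ℝ => Real.exp (-(L * Fintype.card κ)) *
        gksSum Finset.univ (Sum.elim K (fun _ => L)) (Sum.elim C' E) G) atTop
      (𝓝 (∑ ω ∈ Finset.univ.filter P, G ω * gksWeight Finset.univ K C' ω)) := by
  -- factorisation of the weight of one configuration
  have hw : ∀ (L : ℝ) (ω : SpinConfig W), Real.exp (-(L * Fintype.card κ)) *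
        gksWeight Finset.univ (Sum.elim K (fun _ => L)) (Sum.elim C' E) ω
      = gksWeight Finset.univ K C' ω * Real.exp (L * ∑ e, (spinProduct (E e) ω - 1)) := by
    intro L ω
    rw [gksWeight, gksWeight, gksHamiltonian, gksHamiltonian, Fintype.sum_sum_type,
      ← Real.exp_add, ← Real.exp_add]
    congr 1
    simp only [Sum.elim_inl, Sum.elim_inr]
    rw [Finset.mul_sum]
    simp only [mul_sub, mul_one, Finset.sum_sub_distrib, Finset.sum_const, Finset.card_univ,
      nsmul_eq_mul]
    ring
  have hS : ∑ ω ∈ Finset.univ.filter P, G ω * gksWeight Finset.univ K C' ω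
      = ∑ ω, G ω * (gksWeight Finset.univ K C' ω * if P ω then 1 else 0) := by
    rw [Finset.sum_filter]
    exact Finset.sum_congr rfl fun ω _ => by split_ifs <;> simp
  have hfun : (fun L : ℝ => Real.exp (-(L * Fintype.card κ)) *
        gksSum Finset.univ (Sum.elim K (fun _ => L)) (Sum.elim C' E) G)
      = fun L => ∑ ω, G ω *
          (gksWeight Finset.univ K C' ω * Real.exp (L * ∑ e, (spinProduct (E e) ω - 1))) := by
    funext L
    rw [gksSum, Finset.mul_sum]
    exact Finset.sum_congr rfl fun ω _ => by rw [← hw L ω]; ring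
  rw [hS, hfun]
  refine tendsto_finsetSum _ fun ω _ => tendsto_const_nhds.mul (tendsto_const_nhds.mul ?_)
  by_cases hPω : P ω
  · have hall : ∀ e, spinProduct (E e) ω = 1 := (hP ω).1 hPω
    simp only [hall, sub_self, Finset.sum_const_zero, mul_zero, Real.exp_zero, if_pos hPω]
    exact tendsto_const_nhds
  · rw [if_neg hPω]
    obtain ⟨e₀, he₀⟩ : ∃ e, spinProduct (E e) ω ≠ 1 :=
      not_forall.1 fun hcon => hPω ((hP ω).2 hcon)
    have hneg : ∑ e, (spinProduct (E e) ω - 1) < 0 := by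
      classical
      rw [← Finset.add_sum_erase _ _ (Finset.mem_univ e₀),
        (spinProduct_eq_one_or (E e₀) ω).resolve_left he₀]
      have h2 : ∑ e ∈ Finset.univ.erase e₀, (spinProduct (E e) ω - 1) ≤ 0 :=
        Finset.sum_nonpos fun e _ => by
          rcases spinProduct_eq_one_or (E e) ω with h | h <;> rw [h] <;> norm_num
      linarith
    exact Real.tendsto_exp_atBot.comp (tendsto_id.atTop_mul_const_of_neg hneg)

/-- **Contraction limit, normalised.** `⟨G⟩_L → (∑_{ω : extra bonds satisfied} G w) / (∑ w)` as
`L → ∞`; the denominator is positive (the constant configuration `+1` satisfies every bond).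
[folklore] -/
theorem c5_tendsto_gksExpect {W ι κ : Type*} [Fintype W] [DecidableEq W] [Fintype ι] [Fintype κ]
    (K : ι → ℝ) (C' : ι → Finset W) (E : κ → Finset W) (P : SpinConfig W → Prop)
    [DecidablePred P] (hP : ∀ ω, P ω ↔ ∀ e, spinProduct (E e) ω = 1) (G : SpinConfig W → ℝ) :
    Tendsto (fun L : ℝ => gksExpect Finset.univ (Sum.elim K (fun _ => L)) (Sum.elim C' E) G) atTop
      (𝓝 ((∑ ω ∈ Finset.univ.filter P, G ω * gksWeight Finset.univ K C' ω) /
        (∑ ω ∈ Finset.univ.filter P, gksWeight Finset.univ K C' ω))) := by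
  have hpos : 0 < ∑ ω ∈ Finset.univ.filter P, gksWeight Finset.univ K C' ω := by
    refine Finset.sum_pos (fun ω _ => gksWeight_pos _ _ _ ω) ⟨fun _ => 1, ?_⟩
    simp [hP, spinProduct, spinAt]
  have h2 := c5_tendsto_gksSum K C' E P hP (fun _ => 1)
  simp only [one_mul] at h2
  refine ((c5_tendsto_gksSum K C' E P hP G).div h2 hpos.ne').congr fun L => ?_
  rw [Pi.div_apply, mul_div_mul_left _ _ (Real.exp_pos _).ne']
  rfl

/-! ## The cycle blow-up of a pair system with `k + 2` bonds -/

/-- A copy `(p, j)` and its cycle successor `(p, j + 1)` are distinct (`k + 2 ≥ 2`). [folklore] -/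
theorem c5_ne_next {n k : ℕ} (e : Fin n × Fin (k + 2)) : e ≠ (e.1, e.2 + 1) := by
  intro h
  have h1 := congrArg (fun i : Fin (k + 2) => i - e.2) (congrArg Prod.snd h)
  simp at h1

/-- All cycle bonds `{(p, j), (p, j+1)}` are satisfied (`σ_uσ_v = 1` iff the two spins agree) iff
the configuration is constant on every fibre `{p} × Fin (k+2)`. [folklore] -/
theorem c5_cycle_const_iff {n k : ℕ} (ω : SpinConfig (Fin n × Fin (k + 2))) :
    (∀ e : Fin n × Fin (k + 2), spinProduct ({e, (e.1, e.2 + 1)} : Finset _) ω = 1) ↔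
      ∀ (p : Fin n) (j : Fin (k + 2)), ω (p, j) = ω (p, 0) := by
  have hpair : ∀ e : Fin n × Fin (k + 2),
      spinProduct ({e, (e.1, e.2 + 1)} : Finset _) ω = 1 ↔ ω e = ω (e.1, e.2 + 1) := by
    intro e
    rw [spinProduct, Finset.prod_pair (c5_ne_next e)]
    constructor
    · intro h
      have h2 : spinAt e ω = spinAt (e.1, e.2 + 1) ω := by
        linear_combination spinAt (e.1, e.2 + 1) ω * h - spinAt e ω * spinAt_mul_self (e.1, e.2 + 1) ω
      exact Units.ext (Int.cast_injective (α := ℝ) h2)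
    · intro h
      have h2 : spinAt e ω = spinAt (e.1, e.2 + 1) ω := by simp only [spinAt, h]
      rw [h2, spinAt_mul_self]
  simp only [hpair]
  constructor
  · intro h p j
    induction j using Fin.induction with
    | zero => rfl
    | succ j ih => rw [← Fin.coeSucc_eq_succ, ← ih]; exact (h (p, Fin.castSucc j)).symm
  · rintro h ⟨p, j⟩
    rw [h p j, h p (j + 1)]

/-- The fibre-constant configurations are in bijection with the configurations of the heads, and
there the transplanted bonds `{(a, i), (b, i)}` read the head spins:
`∑_{const ω} F(heads ω) w'(ω) = Z⟨F⟩`. [folklore] -/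
theorem c5_sum_const_eq_gksSum {n k : ℕ} (K : Fin (k + 2) → ℝ) (C : Fin (k + 2) → Finset (Fin n))
    (F : SpinConfig (Fin n) → ℝ) :
    ∑ ω ∈ Finset.univ.filter (fun ω : SpinConfig (Fin n × Fin (k + 2)) =>
        ∀ (p : Fin n) (j : Fin (k + 2)), ω (p, j) = ω (p, 0)),
        F (fun p => ω (p, 0)) *
          gksWeight Finset.univ K (fun i => (C i).map (Function.Embedding.sectL (Fin n) i)) ω
      = gksSum Finset.univ K C F := by
  unfold gksSum
  refine Finset.sum_nbij' (fun ω p => ω (p, 0)) (fun σ w => σ w.1) (fun _ _ => Finset.mem_univ _)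
    (fun σ _ => by simp) ?_ (fun _ _ => rfl) ?_
  · intro ω hω
    simp only [Finset.mem_filter, Finset.mem_univ, true_and] at hω
    funext w
    exact (hω w.1 w.2).symm
  · intro ω hω
    simp only [Finset.mem_filter, Finset.mem_univ, true_and] at hω
    -- on a fibre-constant configuration the transplanted weight is the original weight of the heads
    unfold gksWeight gksHamiltonian
    congr 2
    refine Finset.sum_congr rfl fun i _ => ?_
    rw [spinProduct, Finset.prod_map, spinProduct]
    exact congrArg _ (Finset.prod_congr rfl fun a _ => by
      simp only [spinAt, Function.Embedding.sectL_apply, hω a i])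

/-- **The heads of the blow-up converge to the original system**: for every observable `F` of the
heads, `⟨F(heads)⟩_{G_L} → ⟨F⟩` as `L → ∞`. [folklore] -/
theorem c5_tendsto_blowup {n k : ℕ} (K : Fin (k + 2) → ℝ) (C : Fin (k + 2) → Finset (Fin n))
    (F : SpinConfig (Fin n) → ℝ) :
    Tendsto (fun L : ℝ => gksExpect Finset.univ (Sum.elim K (fun _ : Fin n × Fin (k + 2) => L))
        (Sum.elim (fun i => (C i).map (Function.Embedding.sectL (Fin n) i))
          (fun e => ({e, (e.1, e.2 + 1)} : Finset (Fin n × Fin (k + 2)))))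
        (fun ω => F (fun p => ω (p, 0)))) atTop
      (𝓝 (gksExpect Finset.univ K C F)) := by
  have h := c5_tendsto_gksExpect K (fun i => (C i).map (Function.Embedding.sectL (Fin n) i))
    (fun e => ({e, (e.1, e.2 + 1)} : Finset (Fin n × Fin (k + 2))))
    (fun ω => ∀ (p : Fin n) (j : Fin (k + 2)), ω (p, j) = ω (p, 0))
    (fun ω => (c5_cycle_const_iff ω).symm) (fun ω => F (fun p => ω (p, 0)))
  have hden := c5_sum_const_eq_gksSum K C (fun _ => 1)
  simp only [one_mul] at hden
  rw [c5_sum_const_eq_gksSum K C F, hden] at h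
  exact h

/-- Every copy `(p, j)` lies in at most three bonds of the blow-up: the transplanted bond `j` and
the two cycle bonds `(p, j)`, `(p, j − 1)`. [folklore] -/
theorem c5_deg_blowup {n k : ℕ} (C : Fin (k + 2) → Finset (Fin n)) (w : Fin n × Fin (k + 2)) :
    (Finset.univ.filter (fun b : Fin (k + 2) ⊕ (Fin n × Fin (k + 2)) =>
        w ∈ Sum.elim (fun i => (C i).map (Function.Embedding.sectL (Fin n) i))
          (fun e => ({e, (e.1, e.2 + 1)} : Finset (Fin n × Fin (k + 2)))) b)).card ≤ 3 := by
  obtain ⟨p, j⟩ := w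
  refine (Finset.card_le_card (t := {Sum.inl j, Sum.inr (p, j), Sum.inr (p, j - 1)})
    fun b hb => ?_).trans Finset.card_le_three
  rw [Finset.mem_filter] at hb
  rcases b with i | ⟨p', j'⟩
  · obtain ⟨a, -, ha⟩ := Finset.mem_map.1 hb.2
    simp only [Function.Embedding.sectL_apply, Prod.mk.injEq] at ha
    obtain ⟨rfl, rfl⟩ := ha
    simp
  · simp only [Sum.elim_inr, Finset.mem_insert, Finset.mem_singleton, Prod.mk.injEq] at hb
    rcases hb.2 with ⟨rfl, rfl⟩ | ⟨rfl, rfl⟩ <;> simp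

/-! ## The stub -/

/-- **C5 · degree reduction (contraction limit).**  IM for all systems of maximal degree ≤ 3 implies IM:
replace every site `p` by a cycle of copies carrying one original bond each and cycle couplings
`L`; as `L → ∞` the Gibbs weights concentrate on fibre-constant configurations, so the second
moments of the heads converge to `Σ`; each approximant is a principal submatrix of an inverse-M
matrix (hence inverse-M), `Σ` is positive definite, and the off-diagonal entries of the inverse pass
to the limit.  (Systems with at most one bond have maximal degree `≤ 1`.) [folklore] -/
theorem stub_im_of_imDeg3 :
    (∀ (n m : ℕ) (K : Fin m → ℝ) (C : Fin m → Finset (Fin n)), (∀ i, 0 ≤ K i) → (∀ i, (C i).card = 2) →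
      (∀ p : Fin n, (Finset.univ.filter (fun i => p ∈ C i)).card ≤ 3) →
      ∀ x y : Fin n, x ≠ y →
        (Matrix.of fun p q : Fin n => gksExpect Finset.univ K C (fun ω => spinAt p ω * spinAt q ω))⁻¹ x y ≤ 0) →
    InverseMFerromagnet := by
  intro H n m K C hK hC x y hxy
  rcases Nat.lt_or_ge m 2 with hm | hm
  · refine H n m K C hK hC (fun p => (Finset.card_filter_le _ _).trans ?_) x y hxy
    rw [Finset.card_univ, Fintype.card_fin]
    omega
  obtain ⟨k, rfl⟩ : ∃ k, m = k + 2 := ⟨m - 2, by omega⟩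
  -- the blow-up `G_L`: couplings `KL L`, supports `CB`, second-moment matrix `SL L`, heads `hd`
  set KL : ℝ → Fin (k + 2) ⊕ (Fin n × Fin (k + 2)) → ℝ := fun L => Sum.elim K (fun _ => L)
  set CB : Fin (k + 2) ⊕ (Fin n × Fin (k + 2)) → Finset (Fin n × Fin (k + 2)) :=
    Sum.elim (fun i => (C i).map (Function.Embedding.sectL (Fin n) i))
      (fun e => ({e, (e.1, e.2 + 1)} : Finset (Fin n × Fin (k + 2))))
  set SL : ℝ → Matrix (Fin n × Fin (k + 2)) (Fin n × Fin (k + 2)) ℝ := fun L =>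
    Matrix.of fun u v => gksExpect Finset.univ (KL L) CB (fun ω => spinAt u ω * spinAt v ω)
  set hd : Fin n ↪ Fin n × Fin (k + 2) := Function.Embedding.sectL (Fin n) (0 : Fin (k + 2))
  -- (i) at fixed `L ≥ 0` the heads' block of `SL L` is inverse-M, so its inverse is a Z-matrix
  have hnonpos : ∀ L : ℝ, 0 ≤ L → ((SL L).submatrix hd hd)⁻¹ x y ≤ 0 := by
    intro L hL
    have hKL0 : ∀ b, 0 ≤ KL L b := by rintro (i | e); exacts [hK i, hL]
    have hCB2 : ∀ b, (CB b).card = 2 := by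
      rintro (i | e)
      · simpa only [CB, Sum.elim_inl, Finset.card_map] using hC i
      · exact Finset.card_pair (c5_ne_next e)
    have hIM : IsInverseMMatrix (SL L) :=
      ⟨fun u v => c5_corr_nonneg (KL L) CB hKL0 u v,
        (Matrix.isUnit_iff_isUnit_det _).1 (c5_posDef Finset.univ (KL L) CB).isUnit,
        fun u v huv => c5_reindex H (KL L) CB hKL0 hCB2 (c5_deg_blowup C) u v huv⟩
    exact ((principalSubmatrix_closure_holds _ _ (SL L) hd).1 hIM).2.2 x y hxy
  -- (ii) the heads' block converges to `Σ` as `L → ∞`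
  have hlim : Tendsto (fun L => (SL L).submatrix hd hd) atTop
      (𝓝 (Matrix.of fun p q : Fin n =>
        gksExpect Finset.univ K C (fun ω => spinAt p ω * spinAt q ω))) :=
    tendsto_pi_nhds.2 fun p => tendsto_pi_nhds.2 fun q =>
      c5_tendsto_blowup K C (fun ω => spinAt p ω * spinAt q ω)
  -- (iii) `Σ` is positive definite, so inversion is continuous at `Σ` and the sign passes to the limit
  have hdet : (Matrix.of fun p q : Fin n =>
      gksExpect Finset.univ K C (fun ω => spinAt p ω * spinAt q ω)).det ≠ 0 :=
    (c5_posDef Finset.univ K C).det_pos.ne'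
  have hinv := ((continuous_id.matrix_elem x y).tendsto _).comp (((continuousAt_matrix_inv _
    (by rw [Ring.inverse_eq_inv']; exact continuousAt_inv₀ hdet)).tendsto).comp hlim)
  exact le_of_tendsto hinv (Filter.eventually_atTop.2 ⟨0, hnonpos⟩)

end Summit.CriticalPhenomena.Ising3DConformalLimit.Cruxes.InverseMFerromagnet.PartialCovarianceLadder
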